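import Summits.QuantumFields.YangMills.Theorems.BalabanUVNodesN07AliasSumPositivityCore
import HarnessLib

/-!
# DAG node N07 (road R0′ at the record; the `hker` ∕ `hpos` letter) — THE EXPLICIT ONE-LEVEL MARGIN, part 1 (abstract core):
# one-coordinate domination constants MULTIPLY: the aliased alternating (CENTRE) sum dominates `Π_κ w_κ` times the `s⁻²`-weighted (MATCHED) sum

Width seat `pub-ymgap-dag-n07-w7` (g4), `--supports stmt-QuantumFields-26907 --as helper`; count-neutral; 0 `def`.
Road item (L1) of dag-n07-w5's `LOCATED-PD-LOCALIZATION-ROAD.md` §3 = the QUANTITATIVE edition of this lineage's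
`aliasCore_pos` (p613440), integral-free, in the `iterMono` ∕ `transfer` vocabulary of `…N07AliasSumPositivityCore`.

WHAT.  §1 a quantitative odd valley lemma: the alternating sum of `valleyAlt_sum_pos` EXCEEDS its first pair `a₀ − a₁` and
its last pair `a_{2r} − a_{2r−1}`.  §2 one coordinate: for `F ∈ iterMono 1`, `x ≥ 0`, positive hill-shaped data `s` whose
minimum sits at an END `e ∈ {0, L−1}` and at least DOUBLES at the neighbour `e'` (`2 s_e ≤ s_{e'}`; odd `L ≥ 3`),
★ `transfer L s F x ≥ F(x + s_e²)∕(2 s_e)` while the matched sum `Σ_m F(x + s_m²)∕s_m² ≤ (Σ_m s_m⁻²)·F(x + s_e²)`, hence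
★★ `matchedSum_le_transfer`: `Σ_m F(x+s_m²)∕s_m² ≤ 2 s_e (Σ_m s_m⁻²) · transfer L s F x` — ONE way to produce a one-coordinate
DOMINATION CONSTANT `w` with `w · Σ_m G(x+s_m²)∕s_m² ≤ transfer L s G x` for all `G ∈ iterMono 1`, `x ≥ 0`.  §3 all coordinates
by induction exactly as in `aliasCore_iterMono` (the inner sum is `iterMono 1`; the matched weights `s⁻²` are positive, so the
induction hypothesis is inserted under them): ★★★ `aliasCore_margin_fin` ∕ `aliasCore_margin` — domination constants MULTIPLY:
`(Π_κ w κ) · Σ_{m : J → Fin L} (Π_κ (s κ (m κ))⁻²) F(x + Σ_κ (s κ (m κ))²) ≤ Σ_m (Π_κ (−1)^{m κ}∕s κ (m κ)) F(x + Σ_κ (s κ (m κ))²)`.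
Part 2 (`…N07AliasSumMargin`) feeds the sine data (`w_κ = sin(θ_κ∕2)∕(πL)` via King's aliasing identity `Σ_m s_m⁻² = L²∕sin²(ϑ∕2)`
and Jordan's inequality — dag-n07-w5 g2's located OFFER (iii)) and concludes «`K₀(θ) ≤ π^{|J|}·K(θ)`» (block-MEAN symbol vs the
CENTRE-sampling symbol of `aliasSymbolK_pos`), uniformly in `L` and in the coarse torus.

HONEST SCOPE.  Elementary real analysis on finite sums ([folklore] throughout); nothing of [B11]∕[B6]∕[3] is asserted; road
items (L2) (discrete Caccioppoli), (L4) (assembly) and the multi-level `(P)_D` stay OPEN; `hker`, stub 1, K0⁷∕K1⁸ NOT closed;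
N07 not discharged; nothing continuum ∕ OS ∕ mass gap ∕ Clay.  Context: T. Bałaban, CMP **96** (1984) 223–250
[Balaban1984PropagatorsII] (2.22) p.226; CMP **109** (1987) [Balaban1987RG1] (0.4) p.253 — nothing is cited as a hypothesis.
-/

set_option autoImplicit false

noncomputable section

open Finset

namespace Summit.QuantumFields.YangMills.Theorems.N07AliasSumMargin

open Summit.QuantumFields.YangMills.Theorems.N07AliasSumPositivity

/-! ## §1  The odd valley lemma, quantitative: the alternating sum exceeds its end pairs -/

/-- ★ An alternating sum of odd length `2r+1 ≥ 3` over a positive sequence of the relaxed valley shape of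
`valleyAlt_sum_pos` (non-increasing on `[0,p]`, non-decreasing on `[p+1, 2r]`) EXCEEDS ITS FIRST PAIR:
`a 0 − a 1 < Σ_{m ≤ 2r} (−1)^m a m` — peel the first pair; what remains is again an odd valley, positive by
`valleyAlt_sum_pos`. [folklore] -/
theorem first_sub_second_lt_valleyAlt_sum (r : ℕ) (hr : 1 ≤ r) (a : ℕ → ℝ) (p : ℕ)
    (hpos : ∀ m, m ≤ 2 * r → 0 < a m)
    (hdown : ∀ m m', m ≤ m' → m' ≤ p → m' ≤ 2 * r → a m' ≤ a m)
    (hup : ∀ m m', p + 1 ≤ m → m ≤ m' → m' ≤ 2 * r → a m ≤ a m') :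
    a 0 - a 1 < ∑ m ∈ range (2 * r + 1), (-1 : ℝ) ^ m * a m := by
  obtain ⟨r', rfl⟩ : ∃ r', r = r' + 1 := ⟨r - 1, by omega⟩
  rw [show 2 * (r' + 1) + 1 = 2 * r' + 1 + 1 + 1 by ring, sum_range_succ', sum_range_succ']
  have hrec : 0 < ∑ m ∈ range (2 * r' + 1), (-1 : ℝ) ^ m * a (m + 1 + 1) := by
    refine valleyAlt_sum_pos r' (fun m => a (m + 1 + 1)) (p - 2) (fun m hm => hpos _ (by omega)) ?_ ?_
    · intro m m' h1 h2 h3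
      rcases Nat.eq_or_lt_of_le h1 with h | h
      · rw [h]
      · exact hdown _ _ (by omega) (by omega) (by omega)
    · intro m m' h1 h2 h3
      exact hup _ _ (by omega) (by omega) (by omega)
  have e : ∀ m : ℕ, (-1 : ℝ) ^ (m + 1 + 1) * a (m + 1 + 1) = (-1 : ℝ) ^ m * a (m + 1 + 1) := by
    intro m; rw [pow_succ, pow_succ]; ring
  simp only [e, pow_zero, one_mul, zero_add, pow_one]
  linarith

/-- The same alternating sum EXCEEDS ITS LAST PAIR: `a (2r) − a (2r−1) < Σ_{m ≤ 2r} (−1)^m a m` (reflect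
`m ↦ 2r − m`, which preserves the signs and turns the valley around). [folklore] -/
theorem last_sub_pred_lt_valleyAlt_sum (r : ℕ) (hr : 1 ≤ r) (a : ℕ → ℝ) (p : ℕ)
    (hpos : ∀ m, m ≤ 2 * r → 0 < a m)
    (hdown : ∀ m m', m ≤ m' → m' ≤ p → m' ≤ 2 * r → a m' ≤ a m)
    (hup : ∀ m m', p + 1 ≤ m → m ≤ m' → m' ≤ 2 * r → a m ≤ a m') :
    a (2 * r) - a (2 * r - 1) < ∑ m ∈ range (2 * r + 1), (-1 : ℝ) ^ m * a m := by
  -- the reflected sequence `b m = a (2r - m)` is a valley with turning index `2r - (p+1)`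
  have h := first_sub_second_lt_valleyAlt_sum r hr (fun m => a (2 * r - m)) (2 * r - (p + 1))
    (fun m hm => hpos _ (by omega)) ?_ ?_
  rotate_left
  · intro m m' h1 h2 h3
    rcases Nat.eq_or_lt_of_le h1 with h | h
    · rw [h]
    · exact hup _ _ (by omega) (by omega) (by omega)
  · intro m m' h1 h2 h3
    rcases Nat.eq_or_lt_of_le h2 with h | h
    · rw [h]
    · exact hdown _ _ (by omega) (by omega) (by omega)
  have hrefl : ∑ m ∈ range (2 * r + 1), (-1 : ℝ) ^ m * a (2 * r - m) =
      ∑ m ∈ range (2 * r + 1), (-1 : ℝ) ^ m * a m := by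
    rw [← sum_range_reflect (fun m => (-1 : ℝ) ^ m * a m) (2 * r + 1)]
    refine sum_congr rfl (fun m hm => ?_)
    rw [mem_range] at hm
    have hsgn : (-1 : ℝ) ^ (2 * r + 1 - 1 - m) = (-1 : ℝ) ^ m := by
      have h1 : (-1 : ℝ) ^ (2 * r + 1 - 1 - m) * (-1 : ℝ) ^ m = 1 := by
        rw [← pow_add, show 2 * r + 1 - 1 - m + m = 2 * r by omega, pow_mul]; norm_num
      have h2 : (-1 : ℝ) ^ m * (-1 : ℝ) ^ m = 1 := by
        rw [← pow_add, ← two_mul, pow_mul]; norm_num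
      calc (-1 : ℝ) ^ (2 * r + 1 - 1 - m) = (-1 : ℝ) ^ (2 * r + 1 - 1 - m) * ((-1 : ℝ) ^ m * (-1 : ℝ) ^ m) := by
            rw [h2, mul_one]
        _ = ((-1 : ℝ) ^ (2 * r + 1 - 1 - m) * (-1 : ℝ) ^ m) * (-1 : ℝ) ^ m := by ring
        _ = (-1 : ℝ) ^ m := by rw [h1, one_mul]
    rw [hsgn, show 2 * r + 1 - 1 - m = 2 * r - m by omega]
  have h0 : (fun m => a (2 * r - m)) 0 - (fun m => a (2 * r - m)) 1 = a (2 * r) - a (2 * r - 1) := by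
    simp only [Nat.sub_zero]
  rw [h0, hrefl] at h
  exact h

/-! ## §2  One coordinate: the transfer against the matched sum -/

/-- ★ **The transfer exceeds half its minimal end term (left end).**  For odd `L ≥ 3`, positive hill-shaped data `s`,
`F` positive and non-increasing on `(0,∞)` (`F ∈ iterMono 1`), `x ≥ 0`, and `2·s 0 ≤ s 1`:
`F (x + (s 0)²) ∕ (2 s 0) ≤ transfer L s F x` (§1 on the valley `m ↦ F(x + (s m)²)∕s m` of `transfer_pos`). [folklore] -/
theorem transfer_ge_half_left {L : ℕ} (hL : Odd L) (h3 : 3 ≤ L) {s : ℕ → ℝ} (hs0 : ∀ m, m < L → 0 < s m) {p : ℕ}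
    (hs : (∀ m m', m ≤ m' → m' ≤ p → m' < L → s m ≤ s m') ∧
      (∀ m m', p + 1 ≤ m → m ≤ m' → m' < L → s m' ≤ s m))
    (h01 : 2 * s 0 ≤ s 1) {F : ℝ → ℝ} (hF : F ∈ iterMono 1) {x : ℝ} (hx : 0 ≤ x) :
    F (x + s 0 ^ 2) / (2 * s 0) ≤ transfer L s F x := by
  obtain ⟨r, rfl⟩ := hL
  unfold transfer
  have e : ∀ m ∈ range (2 * r + 1), (-1 : ℝ) ^ m / s m * F (x + s m ^ 2) =
      (-1 : ℝ) ^ m * ((s m)⁻¹ * F (x + s m ^ 2)) := by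
    intro m _; rw [div_eq_mul_inv]; ring
  rw [sum_congr rfl e]
  have harg : ∀ m, m < 2 * r + 1 → 0 < x + s m ^ 2 := fun m hm => by
    have := hs0 m hm; positivity
  have hcmp : ∀ m m', m < 2 * r + 1 → m' < 2 * r + 1 → s m ≤ s m' →
      (s m')⁻¹ * F (x + s m' ^ 2) ≤ (s m)⁻¹ * F (x + s m ^ 2) := by
    intro m m' hm hm' hle
    have h1 : (s m')⁻¹ ≤ (s m)⁻¹ := (inv_le_inv₀ (hs0 m' hm') (hs0 m hm)).mpr hle
    have h2 : F (x + s m' ^ 2) ≤ F (x + s m ^ 2) :=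
      iterMono_antitone hF (harg m hm) (by nlinarith [hs0 m hm, hs0 m' hm'])
    exact mul_le_mul h1 h2 (iterMono_pos hF (harg m' hm')).le (inv_pos.mpr (hs0 m hm)).le
  have hlt := first_sub_second_lt_valleyAlt_sum r (by omega) (fun m => (s m)⁻¹ * F (x + s m ^ 2)) p
    (fun m hm => mul_pos (inv_pos.mpr (hs0 m (by omega))) (iterMono_pos hF (harg m (by omega))))
    (fun m m' h1 h2 h3 => hcmp m m' (by omega) (by omega) (hs.1 m m' h1 h2 (by omega)))
    (fun m m' h1 h2 h3 => hcmp m' m (by omega) (by omega) (hs.2 m m' h1 h2 (by omega)))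
  have hs0' := hs0 0 (by omega)
  have hs1 := hs0 1 (by omega)
  have hF0 := iterMono_pos hF (harg 0 (by omega))
  have hF01 : F (x + s 1 ^ 2) ≤ F (x + s 0 ^ 2) :=
    iterMono_antitone hF (harg 0 (by omega)) (by nlinarith)
  have hpair : (s 1)⁻¹ * F (x + s 1 ^ 2) ≤ (2 * s 0)⁻¹ * F (x + s 0 ^ 2) :=
    mul_le_mul ((inv_le_inv₀ hs1 (by positivity)).mpr h01) hF01 (iterMono_pos hF (harg 1 (by omega))).le
      (inv_pos.mpr (by positivity)).le
  have key : F (x + s 0 ^ 2) / (2 * s 0) = (s 0)⁻¹ * F (x + s 0 ^ 2) - (2 * s 0)⁻¹ * F (x + s 0 ^ 2) := by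
    field_simp; ring
  rw [key]
  have hlt' : (fun m => (s m)⁻¹ * F (x + s m ^ 2)) 0 - (fun m => (s m)⁻¹ * F (x + s m ^ 2)) 1 <
      ∑ m ∈ range (2 * r + 1), (-1 : ℝ) ^ m * ((s m)⁻¹ * F (x + s m ^ 2)) := hlt
  simp only at hlt'
  linarith

/-- ★ **The transfer exceeds half its minimal end term (right end).**  As `transfer_ge_half_left` with
`2·s (L−1) ≤ s (L−2)`: `F (x + (s (L−1))²) ∕ (2 s (L−1)) ≤ transfer L s F x`. [folklore] -/
theorem transfer_ge_half_right {L : ℕ} (hL : Odd L) (h3 : 3 ≤ L) {s : ℕ → ℝ} (hs0 : ∀ m, m < L → 0 < s m) {p : ℕ}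
    (hs : (∀ m m', m ≤ m' → m' ≤ p → m' < L → s m ≤ s m') ∧
      (∀ m m', p + 1 ≤ m → m ≤ m' → m' < L → s m' ≤ s m))
    (hlast : 2 * s (L - 1) ≤ s (L - 2)) {F : ℝ → ℝ} (hF : F ∈ iterMono 1) {x : ℝ} (hx : 0 ≤ x) :
    F (x + s (L - 1) ^ 2) / (2 * s (L - 1)) ≤ transfer L s F x := by
  obtain ⟨r, rfl⟩ := hL
  rw [show 2 * r + 1 - 1 = 2 * r by omega] at hlast ⊢
  rw [show 2 * r + 1 - 2 = 2 * r - 1 by omega] at hlast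
  unfold transfer
  have e : ∀ m ∈ range (2 * r + 1), (-1 : ℝ) ^ m / s m * F (x + s m ^ 2) =
      (-1 : ℝ) ^ m * ((s m)⁻¹ * F (x + s m ^ 2)) := by
    intro m _; rw [div_eq_mul_inv]; ring
  rw [sum_congr rfl e]
  have harg : ∀ m, m < 2 * r + 1 → 0 < x + s m ^ 2 := fun m hm => by
    have := hs0 m hm; positivity
  have hcmp : ∀ m m', m < 2 * r + 1 → m' < 2 * r + 1 → s m ≤ s m' →
      (s m')⁻¹ * F (x + s m' ^ 2) ≤ (s m)⁻¹ * F (x + s m ^ 2) := by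
    intro m m' hm hm' hle
    have h1 : (s m')⁻¹ ≤ (s m)⁻¹ := (inv_le_inv₀ (hs0 m' hm') (hs0 m hm)).mpr hle
    have h2 : F (x + s m' ^ 2) ≤ F (x + s m ^ 2) :=
      iterMono_antitone hF (harg m hm) (by nlinarith [hs0 m hm, hs0 m' hm'])
    exact mul_le_mul h1 h2 (iterMono_pos hF (harg m' hm')).le (inv_pos.mpr (hs0 m hm)).le
  have hlt := last_sub_pred_lt_valleyAlt_sum r (by omega) (fun m => (s m)⁻¹ * F (x + s m ^ 2)) p
    (fun m hm => mul_pos (inv_pos.mpr (hs0 m (by omega))) (iterMono_pos hF (harg m (by omega))))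
    (fun m m' h1 h2 h3 => hcmp m m' (by omega) (by omega) (hs.1 m m' h1 h2 (by omega)))
    (fun m m' h1 h2 h3 => hcmp m' m (by omega) (by omega) (hs.2 m m' h1 h2 (by omega)))
  have hsL := hs0 (2 * r) (by omega)
  have hsL' := hs0 (2 * r - 1) (by omega)
  have hF0 := iterMono_pos hF (harg (2 * r) (by omega))
  have hF01 : F (x + s (2 * r - 1) ^ 2) ≤ F (x + s (2 * r) ^ 2) :=
    iterMono_antitone hF (harg (2 * r) (by omega)) (by nlinarith)
  have hpair : (s (2 * r - 1))⁻¹ * F (x + s (2 * r - 1) ^ 2) ≤ (2 * s (2 * r))⁻¹ * F (x + s (2 * r) ^ 2) :=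
    mul_le_mul ((inv_le_inv₀ hsL' (by positivity)).mpr hlast) hF01
      (iterMono_pos hF (harg (2 * r - 1) (by omega))).le (inv_pos.mpr (by positivity)).le
  have key : F (x + s (2 * r) ^ 2) / (2 * s (2 * r)) =
      (s (2 * r))⁻¹ * F (x + s (2 * r) ^ 2) - (2 * s (2 * r))⁻¹ * F (x + s (2 * r) ^ 2) := by
    field_simp; ring
  rw [key]
  have hlt' : (fun m => (s m)⁻¹ * F (x + s m ^ 2)) (2 * r) - (fun m => (s m)⁻¹ * F (x + s m ^ 2)) (2 * r - 1) <
      ∑ m ∈ range (2 * r + 1), (-1 : ℝ) ^ m * ((s m)⁻¹ * F (x + s m ^ 2)) := hlt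
  simp only at hlt'
  linarith

/-- The MATCHED one-coordinate sum against its largest term: if `s e ≤ s m` for all `m < L` and `F` is positive
non-increasing, `Σ_{m<L} F(x + (s m)²) ∕ (s m)² ≤ (Σ_{m<L} (s m)⁻²) · F(x + (s e)²)`. [folklore] -/
theorem matchedSum_le_sumInvSq_mul {L : ℕ} {s : ℕ → ℝ} (hs0 : ∀ m, m < L → 0 < s m) {e : ℕ} (he : e < L)
    (hmin : ∀ m, m < L → s e ≤ s m) {F : ℝ → ℝ} (hF : F ∈ iterMono 1) {x : ℝ} (hx : 0 ≤ x) :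
    ∑ m ∈ range L, F (x + s m ^ 2) / s m ^ 2 ≤ (∑ m ∈ range L, (s m ^ 2)⁻¹) * F (x + s e ^ 2) := by
  have hse := hs0 e he
  rw [sum_mul]
  refine sum_le_sum (fun m hm => ?_)
  rw [mem_range] at hm
  have hsm := hs0 m hm
  have hem := hmin m hm
  have h1 : F (x + s m ^ 2) ≤ F (x + s e ^ 2) :=
    iterMono_antitone hF (by positivity) (by nlinarith)
  rw [div_eq_inv_mul]
  exact mul_le_mul_of_nonneg_left h1 (by positivity)

/-- ★★ **One coordinate, matched vs centre.**  For odd `L ≥ 3`, positive hill-shaped `s` whose minimum sits at an END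
`e ∈ {0, L−1}` and at least doubles at the neighbour `e'` (`2·s e ≤ s e'`), `F ∈ iterMono 1` and `x ≥ 0`:
`Σ_{m<L} F(x + (s m)²) ∕ (s m)² ≤ 2 s e · (Σ_{m<L} (s m)⁻²) · transfer L s F x` — i.e. `w := (2 s e Σ_m (s m)⁻²)⁻¹` is a
one-coordinate DOMINATION CONSTANT in the sense of `aliasCore_margin`. [folklore] -/
theorem matchedSum_le_transfer {L : ℕ} (hL : Odd L) (h3 : 3 ≤ L) {s : ℕ → ℝ}
    (hs0 : ∀ m, m < L → 0 < s m) {p : ℕ}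
    (hs : (∀ m m', m ≤ m' → m' ≤ p → m' < L → s m ≤ s m') ∧
      (∀ m m', p + 1 ≤ m → m ≤ m' → m' < L → s m' ≤ s m))
    {e e' : ℕ} (he : (e = 0 ∧ e' = 1) ∨ (e = L - 1 ∧ e' = L - 2))
    (hmin : ∀ m, m < L → s e ≤ s m) (h2 : 2 * s e ≤ s e')
    {F : ℝ → ℝ} (hF : F ∈ iterMono 1) {x : ℝ} (hx : 0 ≤ x) :
    ∑ m ∈ range L, F (x + s m ^ 2) / s m ^ 2
      ≤ (2 * s e * ∑ m ∈ range L, (s m ^ 2)⁻¹) * transfer L s F x := by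
  have heL : e < L := by rcases he with ⟨h, _⟩ | ⟨h, _⟩ <;> omega
  have hse := hs0 e heL
  have hA := matchedSum_le_sumInvSq_mul hs0 heL hmin hF hx
  have hB : F (x + s e ^ 2) / (2 * s e) ≤ transfer L s F x := by
    rcases he with ⟨h1, h1'⟩ | ⟨h1, h1'⟩
    · subst h1; subst h1'
      exact transfer_ge_half_left hL h3 hs0 hs h2 hF hx
    · subst h1; subst h1'
      exact transfer_ge_half_right hL h3 hs0 hs h2 hF hx
  have hZ : 0 ≤ ∑ m ∈ range L, (s m ^ 2)⁻¹ := sum_nonneg (fun m _ => by positivity)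
  calc ∑ m ∈ range L, F (x + s m ^ 2) / s m ^ 2
      ≤ (∑ m ∈ range L, (s m ^ 2)⁻¹) * F (x + s e ^ 2) := hA
    _ = (2 * s e * ∑ m ∈ range L, (s m ^ 2)⁻¹) * (F (x + s e ^ 2) / (2 * s e)) := by field_simp
    _ ≤ (2 * s e * ∑ m ∈ range L, (s m ^ 2)⁻¹) * transfer L s F x :=
        mul_le_mul_of_nonneg_left hB (by positivity)

/-! ## §3  All coordinates -/

/-- Splitting the MATCHED aliased sum over `Fin (n+1) → Fin L` along coordinate `0` (the `s⁻²`-weighted twin of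
`aliasSum_fin_succ_eq_transfer`). [folklore] -/
theorem matchedSum_fin_succ (n L : ℕ) (s : Fin (n + 1) → ℕ → ℝ) (F : ℝ → ℝ) (x : ℝ) :
    ∑ m : Fin (n + 1) → Fin L, (∏ κ, (s κ (m κ) ^ 2)⁻¹) * F (x + ∑ κ, s κ (m κ) ^ 2) =
      ∑ m₀ ∈ range L, (s 0 m₀ ^ 2)⁻¹ * ∑ m' : Fin n → Fin L,
        (∏ κ, (s κ.succ (m' κ) ^ 2)⁻¹) * F ((x + s 0 m₀ ^ 2) + ∑ κ, s κ.succ (m' κ) ^ 2) := by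
  rw [← Fin.sum_univ_eq_sum_range, sum_pi_fin_succ]
  refine Fintype.sum_congr _ _ (fun m₀ => ?_)
  rw [mul_sum]
  refine Fintype.sum_congr _ _ (fun m' => ?_)
  simp only [Fin.prod_univ_succ, Fin.sum_univ_succ, Fin.cons_zero, Fin.cons_succ, add_assoc]
  ring

/-- ★★★ **Domination constants multiply (`Fin n` form).**  For odd `L`, positive hill-shaped families `s κ` (`κ : Fin n`),
non-negative ONE-COORDINATE DOMINATION CONSTANTS `w κ` — `w κ · Σ_{m<L} G(x + (s κ m)²)∕(s κ m)² ≤ transfer L (s κ) G x` for every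
`G ∈ iterMono 1` and `x ≥ 0` — `F` `k`-monotone for every `k`, and `x ≥ 0`:
`(Π_κ w κ) · Σ_{m : Fin n → Fin L} (Π_κ (s κ (m κ))⁻²) F(x + Σ_κ (s κ (m κ))²) ≤ Σ_m (Π_κ (−1)^{m κ} ∕ s κ (m κ)) F(x + Σ_κ (s κ (m κ))²)`
— induction on `n`: the inner alternating sum is `iterMono 1` (`aliasCore_iterMono`), the constant of coordinate `0` is spent on
it, and the induction hypothesis is inserted at the shifted points `x + (s 0 m₀)²` under the positive weights `(s 0 m₀)⁻²`.
[folklore] -/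
theorem aliasCore_margin_fin {L : ℕ} (hL : Odd L) : ∀ (n : ℕ) (s : Fin n → ℕ → ℝ),
    (∀ κ m, m < L → 0 < s κ m) →
    (∀ κ, ∃ p, ((∀ m m', m ≤ m' → m' ≤ p → m' < L → s κ m ≤ s κ m') ∧
      (∀ m m', p + 1 ≤ m → m ≤ m' → m' < L → s κ m' ≤ s κ m))) →
    ∀ (w : Fin n → ℝ), (∀ κ, 0 ≤ w κ) →
    (∀ κ (G : ℝ → ℝ), G ∈ iterMono 1 → ∀ x : ℝ, 0 ≤ x →
      w κ * ∑ m ∈ range L, G (x + s κ m ^ 2) / s κ m ^ 2 ≤ transfer L (s κ) G x) →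
    ∀ (F : ℝ → ℝ), (∀ k, F ∈ iterMono k) → ∀ (x : ℝ), 0 ≤ x →
    (∏ κ, w κ) * ∑ m : Fin n → Fin L, (∏ κ, (s κ (m κ) ^ 2)⁻¹) * F (x + ∑ κ, s κ (m κ) ^ 2)
      ≤ ∑ m : Fin n → Fin L, (∏ κ, (-1 : ℝ) ^ (m κ : ℕ) / s κ (m κ)) * F (x + ∑ κ, s κ (m κ) ^ 2) := by
  intro n
  induction n with
  | zero =>
    intro s _ _ w _ _ F _ x _
    simp only [Finset.univ_eq_empty, Finset.prod_empty, one_mul, le_refl]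
  | succ n ih =>
    intro s hs0 hs w hw0 hw F hF x hx
    -- the inner alternating sum over the coordinates `1, …, n`
    set G : ℝ → ℝ := fun y => ∑ m' : Fin n → Fin L,
        (∏ κ, (-1 : ℝ) ^ (m' κ : ℕ) / s κ.succ (m' κ)) * F (y + ∑ κ, s κ.succ (m' κ) ^ 2) with hG
    have hGm : G ∈ iterMono 1 :=
      aliasCore_iterMono hL n (fun κ => s κ.succ) (fun κ m hm => hs0 κ.succ m hm) (fun κ => hs κ.succ) 1 F (hF _)
    -- induction hypothesis at the shifted points
    have hIH : ∀ m₀ ∈ range L, (∏ κ : Fin n, w κ.succ) *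
        ∑ m' : Fin n → Fin L, (∏ κ, (s κ.succ (m' κ) ^ 2)⁻¹) * F ((x + s 0 m₀ ^ 2) + ∑ κ, s κ.succ (m' κ) ^ 2)
          ≤ G (x + s 0 m₀ ^ 2) := by
      intro m₀ _
      exact ih (fun κ => s κ.succ) (fun κ m hm => hs0 κ.succ m hm) (fun κ => hs κ.succ) (fun κ => w κ.succ)
        (fun κ => hw0 κ.succ) (fun κ => hw κ.succ) F hF (x + s 0 m₀ ^ 2) (add_nonneg hx (sq_nonneg _))
    -- the constant of coordinate `0`
    have hT : w 0 * ∑ m₀ ∈ range L, G (x + s 0 m₀ ^ 2) / s 0 m₀ ^ 2 ≤ transfer L (s 0) G x := hw 0 G hGm x hx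
    have hRHS : ∑ m : Fin (n + 1) → Fin L, (∏ κ, (-1 : ℝ) ^ (m κ : ℕ) / s κ (m κ)) * F (x + ∑ κ, s κ (m κ) ^ 2)
        = transfer L (s 0) G x := aliasSum_fin_succ_eq_transfer n L s F x
    rw [hRHS, matchedSum_fin_succ n L s F x, Fin.prod_univ_succ]
    have hws : ∀ m₀ ∈ range L, 0 ≤ (s 0 m₀ ^ 2)⁻¹ := fun m₀ _ => by positivity
    calc w 0 * (∏ κ : Fin n, w κ.succ) *
          ∑ m₀ ∈ range L, (s 0 m₀ ^ 2)⁻¹ * ∑ m' : Fin n → Fin L,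
            (∏ κ, (s κ.succ (m' κ) ^ 2)⁻¹) * F ((x + s 0 m₀ ^ 2) + ∑ κ, s κ.succ (m' κ) ^ 2)
        = w 0 * ∑ m₀ ∈ range L, (s 0 m₀ ^ 2)⁻¹ * ((∏ κ : Fin n, w κ.succ) *
            ∑ m' : Fin n → Fin L,
              (∏ κ, (s κ.succ (m' κ) ^ 2)⁻¹) * F ((x + s 0 m₀ ^ 2) + ∑ κ, s κ.succ (m' κ) ^ 2)) := by
          rw [mul_assoc, mul_sum]
          refine congrArg _ (sum_congr rfl (fun m₀ _ => ?_))
          ring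
      _ ≤ w 0 * ∑ m₀ ∈ range L, (s 0 m₀ ^ 2)⁻¹ * G (x + s 0 m₀ ^ 2) := by
          refine mul_le_mul_of_nonneg_left (sum_le_sum (fun m₀ hm₀ => ?_)) (hw0 0)
          exact mul_le_mul_of_nonneg_left (hIH m₀ hm₀) (hws m₀ hm₀)
      _ = w 0 * ∑ m₀ ∈ range L, G (x + s 0 m₀ ^ 2) / s 0 m₀ ^ 2 := by
          refine congrArg _ (sum_congr rfl (fun m₀ _ => ?_))
          rw [div_eq_inv_mul]
      _ ≤ transfer L (s 0) G x := hT

/-- ★★★ **Domination constants multiply (any finite index type).**  For odd `L`, positive hill-shaped families `s κ`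
(`κ : J`, `J` finite), non-negative one-coordinate domination constants `w κ`
(`w κ · Σ_{m<L} G(x + (s κ m)²)∕(s κ m)² ≤ transfer L (s κ) G x` for every `G ∈ iterMono 1`, `x ≥ 0`), `F` `k`-monotone for
every `k` on `(0,∞)`, and `x ≥ 0`:
`(Π_κ w κ) · Σ_{m : J → Fin L} (Π_κ (s κ (m κ))⁻²) F(x + Σ_κ (s κ (m κ))²) ≤ Σ_m (Π_κ (−1)^{m κ} ∕ s κ (m κ)) F(x + Σ_κ (s κ (m κ))²)`
— transport to `J = Fin n`. [folklore] -/
theorem aliasCore_margin {J : Type*} [Fintype J] [DecidableEq J] {L : ℕ} (hL : Odd L)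
    (s : J → ℕ → ℝ) (hs0 : ∀ κ m, m < L → 0 < s κ m)
    (hs : ∀ κ, ∃ p, ((∀ m m', m ≤ m' → m' ≤ p → m' < L → s κ m ≤ s κ m') ∧
      (∀ m m', p + 1 ≤ m → m ≤ m' → m' < L → s κ m' ≤ s κ m)))
    (w : J → ℝ) (hw0 : ∀ κ, 0 ≤ w κ)
    (hw : ∀ κ (G : ℝ → ℝ), G ∈ iterMono 1 → ∀ x : ℝ, 0 ≤ x →
      w κ * ∑ m ∈ range L, G (x + s κ m ^ 2) / s κ m ^ 2 ≤ transfer L (s κ) G x)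
    (F : ℝ → ℝ) (hF : ∀ k, F ∈ iterMono k) (x : ℝ) (hx : 0 ≤ x) :
    (∏ κ, w κ) * ∑ m : J → Fin L, (∏ κ, (s κ (m κ) ^ 2)⁻¹) * F (x + ∑ κ, s κ (m κ) ^ 2)
      ≤ ∑ m : J → Fin L, (∏ κ, (-1 : ℝ) ^ (m κ : ℕ) / s κ (m κ)) * F (x + ∑ κ, s κ (m κ) ^ 2) := by
  set n := Fintype.card J with hn
  let eq : J ≃ Fin n := Fintype.equivFinOfCardEq rfl
  have key1 : ∑ m : J → Fin L, (∏ κ, (-1 : ℝ) ^ (m κ : ℕ) / s κ (m κ)) * F (x + ∑ κ, s κ (m κ) ^ 2) =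
      ∑ m : Fin n → Fin L,
        (∏ i, (-1 : ℝ) ^ (m i : ℕ) / s (eq.symm i) (m i)) * F (x + ∑ i, s (eq.symm i) (m i) ^ 2) := by
    refine Fintype.sum_equiv (eq.arrowCongr (Equiv.refl (Fin L))) _ _ (fun m => ?_)
    have h1 : (∏ κ, (-1 : ℝ) ^ (m κ : ℕ) / s κ (m κ)) =
        ∏ i, (-1 : ℝ) ^ ((eq.arrowCongr (Equiv.refl (Fin L)) m) i : ℕ) /
          s (eq.symm i) ((eq.arrowCongr (Equiv.refl (Fin L)) m) i) :=
      Fintype.prod_equiv eq _ _ (fun κ => by simp [Equiv.arrowCongr_apply])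
    have h2 : (∑ κ, s κ (m κ) ^ 2) = ∑ i, s (eq.symm i) ((eq.arrowCongr (Equiv.refl (Fin L)) m) i) ^ 2 :=
      Fintype.sum_equiv eq _ _ (fun κ => by simp [Equiv.arrowCongr_apply])
    rw [h1, h2]
  have key2 : ∑ m : J → Fin L, (∏ κ, (s κ (m κ) ^ 2)⁻¹) * F (x + ∑ κ, s κ (m κ) ^ 2) =
      ∑ m : Fin n → Fin L,
        (∏ i, (s (eq.symm i) (m i) ^ 2)⁻¹) * F (x + ∑ i, s (eq.symm i) (m i) ^ 2) := by
    refine Fintype.sum_equiv (eq.arrowCongr (Equiv.refl (Fin L))) _ _ (fun m => ?_)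
    have h1 : (∏ κ, (s κ (m κ) ^ 2)⁻¹) =
        ∏ i, (s (eq.symm i) ((eq.arrowCongr (Equiv.refl (Fin L)) m) i) ^ 2)⁻¹ :=
      Fintype.prod_equiv eq _ _ (fun κ => by simp [Equiv.arrowCongr_apply])
    have h2 : (∑ κ, s κ (m κ) ^ 2) = ∑ i, s (eq.symm i) ((eq.arrowCongr (Equiv.refl (Fin L)) m) i) ^ 2 :=
      Fintype.sum_equiv eq _ _ (fun κ => by simp [Equiv.arrowCongr_apply])
    rw [h1, h2]
  have key3 : (∏ κ, w κ) = ∏ i, w (eq.symm i) :=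
    Fintype.prod_equiv eq _ _ (fun κ => by simp)
  rw [key1, key2, key3]
  exact aliasCore_margin_fin hL n (fun i => s (eq.symm i)) (fun i m hm => hs0 _ m hm) (fun i => hs _)
    (fun i => w (eq.symm i)) (fun i => hw0 _) (fun i => hw _) F hF x hx

end Summit.QuantumFields.YangMills.Theorems.N07AliasSumMargin

end
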